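import Summits.HubbardSuperconductivity.HubbardSuperconductivity.Theses.PolyaSchurPairBoson
import Summits.AtomisticToContinuum.BoseEinsteinCondensation.Theorems.BECStronglyRayleighSectorGroundStatePerron
import Summits.AtomisticToContinuum.BoseEinsteinCondensation.Theorems.BECStronglyRayleighLatticeCoherenceAssemblyLowerNorm
import Literature.MathematicalPhysics.QuantumLattice.SpinChainsLiebMattisProofs

/-!
# Route `PolyaSchurPairBoson`, support `PlanarCoherenceAssembly` (stmt-HubbardSuperconductivity-10295)

The layer-2 glue of the bosonic engine in `d = 2`, general anisotropy `Δ ∈ (−1, 0]`, sector form: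
`GroundStateStability → StableImpliesPairCoherence → PlanarInsertionDelocalisation →
PairKernelSumRule → SectorPerronXXZ → EasyPlaneCondensate`.

Proof (transcription of the BEC route's `LatticeCoherence.coherence_bound`, Theorems/
BECStronglyRayleighLatticeCoherenceAssembly.lean, to `(ℤ/Mℤ)²` and general `Δ`). Given `Δ, ρ`, take
`ρ₀ = ρ` in `PlanarInsertionDelocalisation` (constant `Mb`) and `M₀ = ⌈2/ρ⌉ + 2`; for even
`M ≥ M₀` and `ρM² ≤ N ≤ M²/2` (so `N ≥ 2`) let `ψ_P` be the Perron vector of the sector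
(`SectorPerronXXZ`) and `φ(S) = Re ψ_P(1_S) ≥ 0`, supported on `N`-sets. `GroundStateStability`
(torus graph connected, `|Δ| ≤ 1`, zero field) makes the occupation polynomial of `φ` stable;
`StableImpliesPairCoherence`, `PlanarInsertionDelocalisation` and `PairKernelSumRule` give
`N(N−1)M²Σφ² ≤ M²Σ_T[…] ≤ Mb Σ_T‖r^T‖² = Mb (N−1)Σ_{x,y}γ(x,y)`, and the generic spin-½ bookkeeping of
the BEC file `…LowerNorm` (`re_norm_lower_eq_pairSum`, `re_norm_eq_sum_sq`) identifies
`Σ_{x,y}γ = ‖S⁻_tot ψ_P‖² = ⟨ψ_P, S⁺_tot S⁻_tot ψ_P⟩` and `Σφ² = ‖ψ_P‖²`. Hence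
`⟨S⁺S⁻⟩_{ψ_P} ≥ N M² ‖ψ_P‖²/max(Mb,1) ≥ (ρ/max(Mb,1)) M⁴ ‖ψ_P‖²`, and Perron uniqueness transfers the
bound to every normalised sector ground state; `c = ρ/max(Mb,1)`.

Sources: E. H. Lieb, R. Seiringer, J. P. Solovej, J. Yngvason (2005) ch. 11; P. Brändén, J. Huh,
Ann. Math. 192 (2020) (Lorentzian polynomials, behind the antecedents); H. Tasaki (2020) §2.4.
No definition is introduced.
-/

set_option linter.dupNamespace false

noncomputable section

namespace Summit.HubbardSuperconductivity.HubbardSuperconductivity.Theorems.PolyaSchurPairBoson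

open scoped BigOperators Matrix ComplexOrder
open Matrix Complex Finset
open Literature.MathematicalPhysics.QuantumLattice Literature.Probability.LatticeModels
open Summit.HubbardSuperconductivity.HubbardSuperconductivity.Theses.PolyaSchurPairBoson
open Summit.AtomisticToContinuum.BoseEinsteinCondensation.Theorems.BECStronglyRayleighSectorPerron
open Summit.AtomisticToContinuum.BoseEinsteinCondensation.Theorems.InsertionFieldDelocalisation.Negative
open Summit.AtomisticToContinuum.BoseEinsteinCondensation.Theorems.LatticeCoherence

/-- **The planar coherence bound** `N · M² · ‖ψ‖² ≤ max(Mb,1) · ‖S⁻_tot ψ‖²` for an entrywise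
nonnegative sector ground vector `ψ` of `xxzHamiltonian 1 (torusGraph 2 M) (−1) Δ`, `|Δ| ≤ 1`,
`N ≥ 2` bosons, from `GroundStateStability`, `StableImpliesPairCoherence`, the planar
insertion-field constant `Mb` and `PairKernelSumRule` (the `N ≥ 2` branch of the BEC route's
`coherence_bound`, in `d = 2` at general `Δ`). [folklore] -/
theorem planar_coherence_bound (hS : GroundStateStability) (hC : StableImpliesPairCoherence)
    (hK : PairKernelSumRule) {Δ : ℝ} (hΔ : |Δ| ≤ 1) {Mb : ℝ} (M : ℕ) [NeZero M] (N : ℕ)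
    (hN2 : 2 ≤ N)
    (hMb : ∀ ψ : TensorIndex (TorusSite 2 M) 2 → ℂ,
        ψ ∈ spinZSector (Λ := TorusSite 2 M) 1 ((N : ℝ) - (M : ℝ) ^ 2 / 2) → ψ ≠ 0 →
        xxzHamiltonian 1 (torusGraph 2 M) (-1) Δ *ᵥ ψ =
          ((lowestEnergyInSector 1 (xxzHamiltonian 1 (torusGraph 2 M) (-1) Δ)
            ((N : ℝ) - (M : ℝ) ^ 2 / 2) : ℝ) : ℂ) • ψ →
        (∀ σ, 0 ≤ (ψ σ).re ∧ (ψ σ).im = 0) →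
        let φ : Finset (TorusSite 2 M) → ℝ := fun S => (ψ (fun x => if x ∈ S then 0 else 1)).re
        let r : Finset (TorusSite 2 M) → TorusSite 2 M → ℝ := fun T x =>
          ∑ y, (if x ∉ T ∧ y ∉ T ∧ x ≠ y then φ (insert x (insert y T)) else 0)
        (M : ℝ) ^ 2 * ∑ T ∈ (Finset.univ : Finset (TorusSite 2 M)).powersetCard (N - 2),
            ((∑ x, r T x ^ 3) / (∑ x, r T x) + (∑ x, r T x ^ 2) ^ 2 / (∑ x, r T x) ^ 2) ≤
          Mb * ∑ T ∈ (Finset.univ : Finset (TorusSite 2 M)).powersetCard (N - 2), ∑ x, r T x ^ 2)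
    (ψ : TensorIndex (TorusSite 2 M) 2 → ℂ) (hψ0 : ψ ≠ 0)
    (hψnn : ∀ σ, 0 ≤ (ψ σ).re ∧ (ψ σ).im = 0)
    (hψsec : ψ ∈ spinZSector (Λ := TorusSite 2 M) 1 ((N : ℝ) - (M : ℝ) ^ 2 / 2))
    (hHψ : xxzHamiltonian 1 (torusGraph 2 M) (-1) Δ *ᵥ ψ =
      ((lowestEnergyInSector 1 (xxzHamiltonian 1 (torusGraph 2 M) (-1) Δ)
        ((N : ℝ) - (M : ℝ) ^ 2 / 2) : ℝ) : ℂ) • ψ) :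
    (N : ℝ) * (M : ℝ) ^ 2 * (star ψ ⬝ᵥ ψ).re ≤
      max Mb 1 * (star ((totalSpin 1 0 - I • totalSpin 1 1 : Op (TorusSite 2 M) 2) *ᵥ ψ) ⬝ᵥ
        ((totalSpin 1 0 - I • totalSpin 1 1 : Op (TorusSite 2 M) 2) *ᵥ ψ)).re := by
  set Sm : Op (TorusSite 2 M) 2 := totalSpin 1 0 - I • totalSpin 1 1 with hSm
  set Q : ℝ := (star (Sm *ᵥ ψ) ⬝ᵥ (Sm *ᵥ ψ)).re with hQ
  set B : ℝ := (star ψ ⬝ᵥ ψ).re with hB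
  have hQnn : 0 ≤ Q := EigenvalueContinuation.re_star_dotProduct_self_nonneg _
  have hmaxM : Mb ≤ max Mb 1 := le_max_left _ _
  have hcard := card_torusSite 2 M
  have hreal : ∀ σ, (ψ σ).im = 0 := fun σ => (hψnn σ).2
  set φ : Finset (TorusSite 2 M) → ℝ := fun S => (ψ (fun x => if x ∈ S then 0 else 1)).re
    with hφdef
  have hφ : ∀ S, φ S = (ψ (fun x => if x ∈ S then 0 else 1)).re := fun S => rfl
  have hφnn : ∀ S, 0 ≤ φ S := fun S => (hψnn _).1
  have hφsupp : ∀ S : Finset (TorusSite 2 M), S.card ≠ N → φ S = 0 := by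
    intro S hS
    rw [hφ, apply_ind_eq_zero_of_card_ne N (by rw [hcard]; push_cast; ring) hψsec S hS,
      Complex.zero_re]
  -- Theorem S on the torus graph at anisotropy `Δ`, zero field
  have hstab : ∀ z : TorusSite 2 M → ℂ, (∀ x, 0 < (z x).im) →
      (∑ S : Finset (TorusSite 2 M), (φ S : ℂ) * ∏ x ∈ S, z x) ≠ 0 := by
    intro z hz
    have h := hS (TorusSite 2 M) (torusGraph 2 M) (torusGraph_connected 2 M) Δ (fun _ => 0)
      hΔ ((N : ℝ) - (M : ℝ) ^ 2 / 2) ψ hψsec hψ0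
    simp only [Complex.ofReal_zero, zero_smul, Finset.sum_const_zero, add_zero] at h
    rw [← occPoly_eq ψ hreal φ hφ z]
    exact h hHψ z hz
  set r : Finset (TorusSite 2 M) → TorusSite 2 M → ℝ := fun T x =>
    ∑ y, (if x ∉ T ∧ y ∉ T ∧ x ≠ y then φ (insert x (insert y T)) else 0) with hrdef
  have h1 : (N : ℝ) * ((N : ℝ) - 1) * ∑ S : Finset (TorusSite 2 M), φ S ^ 2 ≤
      ∑ T ∈ (Finset.univ : Finset (TorusSite 2 M)).powersetCard (N - 2),
        ((∑ x, r T x ^ 3) / (∑ x, r T x) + (∑ x, r T x ^ 2) ^ 2 / (∑ x, r T x) ^ 2) :=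
    hC (TorusSite 2 M) N hN2 φ hφnn hφsupp hstab
  have h2 : (M : ℝ) ^ 2 * ∑ T ∈ (Finset.univ : Finset (TorusSite 2 M)).powersetCard (N - 2),
        ((∑ x, r T x ^ 3) / (∑ x, r T x) + (∑ x, r T x ^ 2) ^ 2 / (∑ x, r T x) ^ 2) ≤
      Mb * ∑ T ∈ (Finset.univ : Finset (TorusSite 2 M)).powersetCard (N - 2), ∑ x, r T x ^ 2 :=
    hMb ψ hψsec hψ0 hHψ hψnn
  have h3 : ∑ T ∈ (Finset.univ : Finset (TorusSite 2 M)).powersetCard (N - 2), ∑ x, r T x ^ 2 =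
      ((N : ℝ) - 1) * ∑ x : TorusSite 2 M, ∑ y : TorusSite 2 M,
        (if x = y then ∑ S : Finset (TorusSite 2 M), (if x ∈ S then φ S ^ 2 else 0)
          else ∑ T ∈ (Finset.univ : Finset (TorusSite 2 M)).powersetCard (N - 1),
            (if x ∉ T ∧ y ∉ T then φ (insert x T) * φ (insert y T) else 0)) :=
    hK (TorusSite 2 M) N hN2 φ hφsupp
  have h4 : (∑ x : TorusSite 2 M, ∑ y : TorusSite 2 M,
        (if x = y then ∑ S : Finset (TorusSite 2 M), (if x ∈ S then φ S ^ 2 else 0)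
          else ∑ T ∈ (Finset.univ : Finset (TorusSite 2 M)).powersetCard (N - 1),
            (if x ∉ T ∧ y ∉ T then φ (insert x T) * φ (insert y T) else 0))) = Q :=
    (re_norm_lower_eq_pairSum N ψ hreal φ hφ hφsupp).symm
  have h5 : B = ∑ S : Finset (TorusSite 2 M), φ S ^ 2 := re_norm_eq_sum_sq ψ hreal φ hφ
  have hpos : (0 : ℝ) < (N : ℝ) - 1 := by
    have : (2 : ℝ) ≤ N := by exact_mod_cast hN2
    linarith
  have hsum_nn : 0 ≤ ∑ T ∈ (Finset.univ : Finset (TorusSite 2 M)).powersetCard (N - 2),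
      ∑ x, r T x ^ 2 :=
    Finset.sum_nonneg fun T _ => Finset.sum_nonneg fun x _ => sq_nonneg _
  have hA : ((N : ℝ) - 1) * ((N : ℝ) * (M : ℝ) ^ 2 * B) ≤ ((N : ℝ) - 1) * (max Mb 1 * Q) := by
    have e1 : ((N : ℝ) - 1) * ((N : ℝ) * (M : ℝ) ^ 2 * B) =
        (M : ℝ) ^ 2 * ((N : ℝ) * ((N : ℝ) - 1) * ∑ S : Finset (TorusSite 2 M), φ S ^ 2) := by
      rw [h5]
      ring
    rw [e1]
    calc (M : ℝ) ^ 2 * ((N : ℝ) * ((N : ℝ) - 1) * ∑ S : Finset (TorusSite 2 M), φ S ^ 2)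
        ≤ (M : ℝ) ^ 2 * ∑ T ∈ (Finset.univ : Finset (TorusSite 2 M)).powersetCard (N - 2),
            ((∑ x, r T x ^ 3) / (∑ x, r T x) + (∑ x, r T x ^ 2) ^ 2 / (∑ x, r T x) ^ 2) :=
          mul_le_mul_of_nonneg_left h1 (by positivity)
      _ ≤ Mb * ∑ T ∈ (Finset.univ : Finset (TorusSite 2 M)).powersetCard (N - 2), ∑ x, r T x ^ 2 :=
          h2
      _ ≤ max Mb 1 * ∑ T ∈ (Finset.univ : Finset (TorusSite 2 M)).powersetCard (N - 2),
            ∑ x, r T x ^ 2 := mul_le_mul_of_nonneg_right hmaxM hsum_nn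
      _ = ((N : ℝ) - 1) * (max Mb 1 * Q) := by rw [h3, h4]; ring
  exact le_of_mul_le_mul_left hA hpos

/-- **`PlanarCoherenceAssembly` holds** (route `PolyaSchurPairBoson`,
item `stmt-HubbardSuperconductivity-10295`): `GroundStateStability → StableImpliesPairCoherence →
PlanarInsertionDelocalisation → PairKernelSumRule → SectorPerronXXZ → EasyPlaneCondensate`, with
`c = ρ/max(Mb,1)` and `M₀ = ⌈2/ρ⌉ + 2`: the planar coherence bound for the Perron vector of the
sector, `⟨ψ, S⁺_tot S⁻_tot ψ⟩ = ‖S⁻_tot ψ‖²`, and Perron uniqueness. [folklore] -/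
theorem planarCoherenceAssembly_proof : PlanarCoherenceAssembly := by
  unfold PlanarCoherenceAssembly PlanarInsertionDelocalisation SectorPerronXXZ EasyPlaneCondensate
  intro hS hC hP hK hX Δ hΔ ρ hρ
  obtain ⟨Mb, hMb⟩ := hP Δ hΔ ρ hρ.1
  have hΔabs : |Δ| ≤ 1 := abs_le.2 ⟨le_of_lt hΔ.1, by linarith [hΔ.2]⟩
  refine ⟨ρ / max Mb 1, by have := hρ.1; positivity, ⌈2 / ρ⌉₊ + 2, ?_⟩
  intro M _ hME hM N hρN hNK ψ hψK hψ1 hHψ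
  -- sizes: `M ≥ 2`, `N ≥ 2`, `N ≤ M²`
  have hM2 : 2 ≤ M := le_trans (Nat.le_add_left 2 _) hM
  have hMreal : (1 : ℝ) ≤ (M : ℝ) := by exact_mod_cast (le_trans (by norm_num) hM2 : 1 ≤ M)
  have hceil : 2 / ρ ≤ (⌈2 / ρ⌉₊ : ℝ) := Nat.le_ceil _
  have hM' : (⌈2 / ρ⌉₊ : ℝ) + 2 ≤ (M : ℝ) := by exact_mod_cast hM
  have hN2real : (2 : ℝ) ≤ (N : ℝ) := by
    have h1 : 2 / ρ * ρ = 2 := div_mul_cancel₀ 2 hρ.1.ne'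
    have h2 : ρ * (M : ℝ) ≤ ρ * (M : ℝ) ^ 2 := by
      have : (M : ℝ) ≤ (M : ℝ) ^ 2 := by nlinarith
      exact mul_le_mul_of_nonneg_left this hρ.1.le
    nlinarith [hρ.1]
  have hN2 : 2 ≤ N := by exact_mod_cast hN2real
  have hNle : N ≤ M ^ 2 := by omega
  -- the Perron vector of the sector
  obtain ⟨ψP, hP0, hPnn, hPK, hHP, huniq⟩ := hX Δ M hM2 N hNle
  have hbound := planar_coherence_bound hS hC hK hΔabs M N hN2
    (fun ψ' h1 h2 h3 h4 => hMb M hM2 N hN2 hρN hNK ψ' h1 h2 h3 h4) ψP hP0 hPnn hPK hHP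
  -- `ψ = c ψP`
  obtain ⟨c, hc⟩ := huniq ψ hψK hHψ
  -- `⟨ψ, S⁺S⁻ ψ⟩ = ‖S⁻ψ‖²`, `S⁻_tot = Sˣ_tot − iSʸ_tot`
  have hsu2 := isSu2Triple_on 1 (Finset.univ : Finset (TorusSite 2 M))
  have hquad : ∀ v : TensorIndex (TorusSite 2 M) 2 → ℂ,
      star v ⬝ᵥ (raiseOn 1 Finset.univ * lowerOn 1 Finset.univ) *ᵥ v =
        star ((totalSpin 1 0 - I • totalSpin 1 1 : Op (TorusSite 2 M) 2) *ᵥ v) ⬝ᵥ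
          ((totalSpin 1 0 - I • totalSpin 1 1 : Op (TorusSite 2 M) 2) *ᵥ v) := by
    intro v
    rw [← lowerOn_univ, hsu2.star_M_mulVec_dotProduct, mulVec_mulVec]
  show ρ / max Mb 1 * (M : ℝ) ^ 4 ≤
    (star ψ ⬝ᵥ (raiseOn 1 Finset.univ * lowerOn 1 Finset.univ) *ᵥ ψ).re
  -- substitute `ψ = c ψP`
  have hcc : star ψ ⬝ᵥ ψ = (starRingEnd ℂ c * c) * (star ψP ⬝ᵥ ψP) := by
    rw [hc, star_smul, smul_dotProduct, dotProduct_smul, smul_smul, smul_eq_mul, Complex.star_def]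
  have hquadc : star ψ ⬝ᵥ (raiseOn 1 Finset.univ * lowerOn 1 Finset.univ) *ᵥ ψ =
      (starRingEnd ℂ c * c) *
        (star ψP ⬝ᵥ (raiseOn 1 Finset.univ * lowerOn 1 Finset.univ) *ᵥ ψP) := by
    rw [hc, mulVec_smul, star_smul, smul_dotProduct, dotProduct_smul, smul_smul, smul_eq_mul,
      Complex.star_def]
  -- `|c|²` is a nonnegative real with `|c|² ‖ψP‖² = 1`
  have hcreal : (starRingEnd ℂ c * c) = ((Complex.normSq c : ℝ) : ℂ) := Complex.normSq_eq_conj_mul_self.symm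
  have hBP : (star ψP ⬝ᵥ ψP).re * Complex.normSq c = 1 := by
    have h := congrArg Complex.re hcc
    rw [hψ1, hcreal, Complex.one_re, Complex.re_ofReal_mul] at h
    linarith [h]
  have hQP := congrArg Complex.re (hquad ψP)
  rw [hquadc, hcreal, Complex.re_ofReal_mul, hQP]
  -- the bound for `ψP`, scaled by `|c|²`
  have hmaxpos : (0 : ℝ) < max Mb 1 := lt_of_lt_of_le one_pos (le_max_right _ _)
  have hnn : 0 ≤ Complex.normSq c := Complex.normSq_nonneg c
  have key : (N : ℝ) * (M : ℝ) ^ 2 * ((star ψP ⬝ᵥ ψP).re * Complex.normSq c) ≤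
      max Mb 1 * (Complex.normSq c *
        (star ((totalSpin 1 0 - I • totalSpin 1 1 : Op (TorusSite 2 M) 2) *ᵥ ψP) ⬝ᵥ
          ((totalSpin 1 0 - I • totalSpin 1 1 : Op (TorusSite 2 M) 2) *ᵥ ψP)).re) := by
    have := mul_le_mul_of_nonneg_right hbound hnn
    nlinarith [this]
  rw [hBP, mul_one] at key
  have key' : (N : ℝ) * (M : ℝ) ^ 2 / max Mb 1 ≤ Complex.normSq c *
      (star ((totalSpin 1 0 - I • totalSpin 1 1 : Op (TorusSite 2 M) 2) *ᵥ ψP) ⬝ᵥ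
        ((totalSpin 1 0 - I • totalSpin 1 1 : Op (TorusSite 2 M) 2) *ᵥ ψP)).re := by
    rw [div_le_iff₀ hmaxpos]
    linarith [key]
  calc ρ / max Mb 1 * (M : ℝ) ^ 4 = (ρ * (M : ℝ) ^ 2) * (M : ℝ) ^ 2 / max Mb 1 := by ring
    _ ≤ (N : ℝ) * (M : ℝ) ^ 2 / max Mb 1 := by
        apply div_le_div_of_nonneg_right _ hmaxpos.le
        exact mul_le_mul_of_nonneg_right hρN (by positivity)
    _ ≤ _ := key'

end Summit.HubbardSuperconductivity.HubbardSuperconductivity.Theorems.PolyaSchurPairBoson
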